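import Mathlib
import Summits.Ventures.PercRepro2.K5Hyper

/-!
# THE `M(H, T, e)` CERTIFICATES, PART 3: `N(H + T(1) + e(1)) ≥ N(H + T(1))` AT EVERY `K₅` PROFILE
(blind cell PercRepro2, typer-1 g10; mine-1 §23.1 `M(H, T, e)`, engine D244 addendum 1 the second code)

One `decide +kernel` per (triangle `T`, pair `e ⊆ T`) (`K5Hyper.lean`: `CertLE (kNegM (triMask T)
(pairMask e)) (kPosM (triMask T) (pairMask e))`).  Twin `k5hyper_typer.py`: `0` violations on all `30`.
-/

namespace Summit.Ventures.PercRepro2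

namespace K5

set_option maxRecDepth 100000 in
/-- `M(H, T, e) ≥ 0` on the triangle `T = {0, 2, 4}`, pair `e = {0, 2}`. -/
theorem cert_M_024_02 :
    CertLE (kNegM (triMask 0 2 4) (pairMask 0 2)) (kPosM (triMask 0 2 4) (pairMask 0 2)) := by
  unfold CertLE
  decide +kernel

set_option maxRecDepth 100000 in
/-- `M(H, T, e) ≥ 0` on the triangle `T = {0, 2, 4}`, pair `e = {0, 4}`. -/
theorem cert_M_024_04 :
    CertLE (kNegM (triMask 0 2 4) (pairMask 0 4)) (kPosM (triMask 0 2 4) (pairMask 0 4)) := by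
  unfold CertLE
  decide +kernel

set_option maxRecDepth 100000 in
/-- `M(H, T, e) ≥ 0` on the triangle `T = {0, 2, 4}`, pair `e = {2, 4}`. -/
theorem cert_M_024_24 :
    CertLE (kNegM (triMask 0 2 4) (pairMask 2 4)) (kPosM (triMask 0 2 4) (pairMask 2 4)) := by
  unfold CertLE
  decide +kernel

set_option maxRecDepth 100000 in
/-- `M(H, T, e) ≥ 0` on the triangle `T = {0, 3, 4}`, pair `e = {0, 3}`. -/
theorem cert_M_034_03 :
    CertLE (kNegM (triMask 0 3 4) (pairMask 0 3)) (kPosM (triMask 0 3 4) (pairMask 0 3)) := by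
  unfold CertLE
  decide +kernel

set_option maxRecDepth 100000 in
/-- `M(H, T, e) ≥ 0` on the triangle `T = {0, 3, 4}`, pair `e = {0, 4}`. -/
theorem cert_M_034_04 :
    CertLE (kNegM (triMask 0 3 4) (pairMask 0 4)) (kPosM (triMask 0 3 4) (pairMask 0 4)) := by
  unfold CertLE
  decide +kernel

set_option maxRecDepth 100000 in
/-- `M(H, T, e) ≥ 0` on the triangle `T = {0, 3, 4}`, pair `e = {3, 4}`. -/
theorem cert_M_034_34 :
    CertLE (kNegM (triMask 0 3 4) (pairMask 3 4)) (kPosM (triMask 0 3 4) (pairMask 3 4)) := by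
  unfold CertLE
  decide +kernel

end K5

end Summit.Ventures.PercRepro2
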